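import Summits.BirchSwinnertonDyer.BirchSwinnertonDyer.Theorems.ResidualThetaTransportAtTwoSignedMuSeedAtTwoPlusPrimCertificateGlue
import Summits.BirchSwinnertonDyer.BirchSwinnertonDyer.Theorems.ThetaPartnerAtTwoSignedTransportAtTwoResidualKummer
import Literature.NumberTheory.EllipticCurves.IwasawaSelmerControlCokerProofs
import Literature.NumberTheory.EllipticCurves.TwoVariableAnticyclotomicControl
import Literature.NumberTheory.EllipticCurves.IwasawaSelmerProofs
import HarnessLib

/-!
# Line `norm-one-torus` of the crux `SignedMuSeedAtTwoPlus` (stmt-BirchSwinnertonDyer-21438; = `stub_residualSeedAtTwo` of Kμ⁺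
# stmt-BirchSwinnertonDyer-20689 BY NAME): the `q = 1` certificate READ AT LAYER `0` — `R[T] = 0` iff the LAYER-`0`
# primitive residual plus-Selmer set `R₀ = res⁻¹(R) ⊆ H¹(ℚ_0, W[2^∞][2])` is trivial
# (width seat bsd-wall-rtt-p4-w3 g6; `--supports stmt-BirchSwinnertonDyer-21438`; closes nothing)

HONEST FRAMING. THEOREMS ONLY (no `def`, no named fact, no `sorry`); nothing about any particular curve is asserted; BSD is not
proved by any of this. The line card (`Lines/norm-one-torus.md`, §S3) reads the first rung of the certificate stub S3 as
«`R[T] = R^Γ ≅` the primitive residual plus-Selmer group over `ℚ`» and certifies it numerically (`dim R₀ = 0`, kit j297640) on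
38/155 `Δ<0` wall cells; this file proves the structural half of that reading in the kernel, for the tree's `H¹` of the layer-`0`
subgroup `Γ_{ℚ_0} = κ⁻¹(ℤ₂) = Γ_ℚ` (`ZpExtension.layerSubgroup_zero`):

* `§1` (any globally minimal `W/ℚ` good supersingular at `2`, any `ℤ₂`-extension `κ`): `resOfLe_layerZero_injective` — the
  restriction `H¹(ℚ_0, W[2^∞][2]) → H¹(ℚ_∞, W[2^∞][2])` is injective (inflation–restriction; `W(ℚ_∞)[2^∞] = 0`,
  `fixedPoints_kerSubgroup_eq_bot_of_goodSS`); `exists_resOfLe_eq_of_conjH1_eq` — a class fixed by `conj_γ` (`γ` a topological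
  generator) is a restriction from `ℚ_0` (Greenberg's Lemma 3.2 at `n = 0`, tree `ZpExtension.mem_range_resOfLe_of_conjH1_eq`);
  `conjH1_resOfLe_layerZero` — conjugation acts trivially on restricted classes.
* `§2` `primCertificate_one_iff_layerZero` — for the primitive residual signed-plus set `R` of the line (unramified at every odd
  place, residually trivial at `∞`, signed-plus at `2`, all over `ℚ_∞`) and `T = conj_γ − 1`:
  «`∃ F` finite, `F = R[T]`, `#F < 2`» (= `PrimCertificate W κ γ 1` of `Lines/norm_one_torus.lean`, unfolded) **iff**
  «every `c₀ ∈ H¹(ℚ_0, W[2^∞][2])` whose restriction to `ℚ_∞` lies in `R` is `0`».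
* `§3` `isTorsion_and_mu_eq_zero_of_layerZero` — hence (per curve, `Δ_W < 0`, `κ` cyclotomic): the layer-`0` condition alone gives
  «every finitely generated `+` signed Selmer dual of `W` at `(κ, γ)` is `Λ`-torsion with `μ = 0`» (door
  `isTorsion_and_mu_eq_zero_of_primCertificate`, p606860, at `q = 1`).

What is NOT here: the comparison of the three local conditions of `res c₀` over `ℚ_∞` with classical conditions on `c₀` over `ℚ`
(odd places and `∞` are formal — inertia and complex conjugation lie in `ker κ`; at `2` it is the layer-`0` signed comparison
INJ⁺@2), i.e. the identification of `R₀` with a `2`-descent object of the cubic field `L_W` (card §S3) — left to the line's lead.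

References: [GreenbergLNM1716] §3 Lemmas 3.1–3.2 (PDF p. 86); [SerreLocalFields1979] VII.§6 Prop. 4; [Fukuda1994] Thm. 1;
[GreenbergVatsal2000] §2; [Kobayashi2003] Def. 1.1.
-/

set_option autoImplicit false
-- D-0017: single-problem summit, so `Summit.BirchSwinnertonDyer.BirchSwinnertonDyer.…` repeats a namespace BY DESIGN.
set_option linter.dupNamespace false

noncomputable section

open scoped Classical AddSubgroup

open WeierstrassCurve NumberField IsDedekindDomain Literature Literature.NumberTheory.EllipticCurves
  Literature.NumberTheory.GaloisRepresentations Literature.NumberTheory.EllipticCurves.GreenbergVatsal2000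
  Literature.NumberTheory.EllipticCurves.Kobayashi2003 ZpExtension
  Literature.NumberTheory.EllipticCurves.GreenbergSelmer
  Literature.NumberTheory.EllipticCurves.Rank1Residual Literature.NumberTheory.EllipticCurves.IwasawaAlgebra
  Summit.BirchSwinnertonDyer.BirchSwinnertonDyer.Theorems.SignedTransportAtTwo

namespace Summit.BirchSwinnertonDyer.BirchSwinnertonDyer.Theorems.SignedMuAtTwo.NormOneTorus

/-! ## §1. Restriction from layer `0`: injective, onto the `conj_γ`-fixed classes, conjugation-trivial -/

section LayerZero

variable (W : WeierstrassCurve ℚ) [W.IsElliptic] [W.IsGloballyMinimal]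

omit [W.IsElliptic] [W.IsGloballyMinimal] in
/-- The points of `W[2^∞][2]` have open stabilisers in `Γ_ℚ` (discrete Galois module). [folklore] -/
theorem isOpen_stabilizer_torsionBy (m : ↥((↥(W.geomPrimaryTorsion 2))[(2 : ℤ)])) :
    IsOpen (MulAction.stabilizer (Field.absoluteGaloisGroup ℚ) m : Set (Field.absoluteGaloisGroup ℚ)) := by
  have hm : (MulAction.stabilizer (Field.absoluteGaloisGroup ℚ) m : Set (Field.absoluteGaloisGroup ℚ)) =
      MulAction.stabilizer (Field.absoluteGaloisGroup ℚ) (((m : ↥(W.geomPrimaryTorsion 2)) : geomPoints W)) := by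
    ext τ
    simp only [SetLike.mem_coe, MulAction.mem_stabilizer_iff]
    rw [Subtype.ext_iff, Subtype.ext_iff]
    rfl
  rw [hm]
  exact isOpen_stabilizer_point_holds W _

/-- **`res : H¹(ℚ_0, W[2^∞][2]) → H¹(ℚ_∞, W[2^∞][2])` is injective** at good supersingular `2` (any `ℤ₂`-extension `κ`):
inflation–restriction with `W(ℚ_∞)[2^∞] = 0`. [cite: GreenbergLNM1716, §3 Lemma 3.1 (PDF p. 86)] [cite: SerreLocalFields1979, VII.§6 Prop. 4] -/
theorem resOfLe_layerZero_injective (hss : GoodSS W 2) (κ : ZpExtension ℚ 2) :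
    Function.Injective
      (Literature.NumberTheory.EllipticCurves.resOfLe ↥((↥(W.geomPrimaryTorsion 2))[(2 : ℤ)]) (κ.kerSubgroup_le_layerSubgroup 0)) := by
  refine resOfLe_injective_of_forall_fixed_eq_zero (κ.kerSubgroup_le_layerSubgroup 0) fun m hm ↦ ?_
  have hfix := fixedPoints_kerSubgroup_eq_bot_of_goodSS W hss κ
  have hmem : (m : ↥(W.geomPrimaryTorsion 2)) ∈ FixedPoints.addSubgroup κ.kerSubgroup (↥(W.geomPrimaryTorsion 2)) := by
    rw [FixedPoints.mem_addSubgroup]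
    intro h
    have := congrArg Subtype.val (hm h h.2)
    exact this
  rw [hfix, AddSubgroup.mem_bot] at hmem
  exact Subtype.ext hmem

omit [W.IsElliptic] [W.IsGloballyMinimal] in
/-- **Greenberg's Lemma 3.2 at `n = 0` for `W[2^∞][2]`**: a class of `H¹(ℚ_∞, W[2^∞][2])` fixed by `conj_γ` (`γ` a topological
generator of the `ℤ₂`-extension) is the restriction of a class of `H¹(ℚ_0, W[2^∞][2])` (`cd ℤ₂ = 1`).
[cite: GreenbergLNM1716, §3 Lemma 3.2 (PDF p. 86)] -/
theorem exists_resOfLe_eq_of_conjH1_eq (κ : ZpExtension ℚ 2) {γ : Field.absoluteGaloisGroup ℚ} (hγ : κ.IsTopGenerator γ)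
    (c : subgroupH1 κ.kerSubgroup ↥((↥(W.geomPrimaryTorsion 2))[(2 : ℤ)]))
    (hc : Literature.NumberTheory.EllipticCurves.conjH1 κ.kerSubgroup ↥((↥(W.geomPrimaryTorsion 2))[(2 : ℤ)]) γ c = c) :
    ∃ c₀ : subgroupH1 (κ.layerSubgroup 0) ↥((↥(W.geomPrimaryTorsion 2))[(2 : ℤ)]),
      Literature.NumberTheory.EllipticCurves.resOfLe ↥((↥(W.geomPrimaryTorsion 2))[(2 : ℤ)]) (κ.kerSubgroup_le_layerSubgroup 0) c₀ = c := by
  have hcont : ∀ m : ↥((↥(W.geomPrimaryTorsion 2))[(2 : ℤ)]), Continuous fun g : Field.absoluteGaloisGroup ℚ ↦ g • m :=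
    fun m ↦ continuous_smul_const_of_isOpen_stabilizer m (isOpen_stabilizer_torsionBy W m)
  have hprim : ∀ m : ↥((↥(W.geomPrimaryTorsion 2))[(2 : ℤ)]), ∃ k : ℕ, 2 ^ k • m = 0 :=
    fun m ↦ ⟨1, by rw [pow_one]; exact AddSubgroup.torsionBy.nsmul m⟩
  have hx : Literature.NumberTheory.EllipticCurves.conjH1 κ.kerSubgroup ↥((↥(W.geomPrimaryTorsion 2))[(2 : ℤ)]) (γ ^ 2 ^ 0) c = c := by
    rw [pow_zero, pow_one]; exact hc
  obtain ⟨c₀, hc₀⟩ := κ.mem_range_resOfLe_of_conjH1_eq hγ 0 hcont hprim c hx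
  exact ⟨c₀, hc₀⟩

omit [W.IsElliptic] [W.IsGloballyMinimal] in
/-- Conjugation acts trivially on classes restricted from layer `0` (`Γ_{ℚ_0} = Γ_ℚ`, inner automorphisms act trivially).
[cite: SerreLocalFields1979, VII.§5 Prop. 3] -/
theorem conjH1_resOfLe_layerZero (κ : ZpExtension ℚ 2) (σ : Field.absoluteGaloisGroup ℚ)
    (c₀ : subgroupH1 (κ.layerSubgroup 0) ↥((↥(W.geomPrimaryTorsion 2))[(2 : ℤ)])) :
    Literature.NumberTheory.EllipticCurves.conjH1 κ.kerSubgroup ↥((↥(W.geomPrimaryTorsion 2))[(2 : ℤ)]) σ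
        (Literature.NumberTheory.EllipticCurves.resOfLe ↥((↥(W.geomPrimaryTorsion 2))[(2 : ℤ)]) (κ.kerSubgroup_le_layerSubgroup 0) c₀) =
      Literature.NumberTheory.EllipticCurves.resOfLe ↥((↥(W.geomPrimaryTorsion 2))[(2 : ℤ)]) (κ.kerSubgroup_le_layerSubgroup 0) c₀ := by
  have hσ : σ ∈ κ.layerSubgroup 0 := by rw [κ.layerSubgroup_zero]; exact Subgroup.mem_top σ
  have h1 := DFunLike.congr_fun
    (resOfLe_comp_conjH1_holds (M := ↥((↥(W.geomPrimaryTorsion 2))[(2 : ℤ)])) (κ.kerSubgroup_le_layerSubgroup 0) σ) c₀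
  simp only [AddMonoidHom.coe_comp, Function.comp_apply] at h1
  rw [← h1, Literature.NumberTheory.EllipticCurves.conjH1_of_mem_holds (κ.layerSubgroup 0) _ hσ, AddMonoidHom.id_apply]

end LayerZero

/-! ## §2. The `q = 1` certificate is the triviality of the layer-`0` primitive residual plus-Selmer set -/

section Certificate

variable (W : WeierstrassCurve ℚ) [W.IsElliptic] [W.IsGloballyMinimal]

/-- **`PrimCertificate W κ γ 1` ⟺ `R₀ = 0`.** For `W/ℚ` globally minimal good supersingular at `2`, a `ℤ₂`-extension `κ` with
topological generator `γ`, the primitive residual signed-plus set `R ⊆ H¹(ℚ_∞, W[2^∞][2])` and `T = conj_γ − 1`: there is a finite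
set of fewer than `2` classes exhausting `R[T]` (the `q = 1` certificate of line `norm-one-torus`, its local definitions unfolded) iff
every class of `H¹(ℚ_0, W[2^∞][2])` restricting into `R` vanishes. (⇐: a class of `R[T]` is `conj_γ`-fixed, hence restricted from
`ℚ_0`, hence `0`; ⇒: `0 ∈ R[T]` forces `F = {0}`, restricted classes are `conj_γ`-fixed, and restriction is injective.)
[cite: GreenbergLNM1716, §3 Lemmas 3.1–3.2 (PDF p. 86)] [cite: Fukuda1994, Thm. 1] -/
theorem primCertificate_one_iff_layerZero (hss : GoodSS W 2) (κ : ZpExtension ℚ 2) (γ : Field.absoluteGaloisGroup ℚ)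
    (hγ : κ.IsTopGenerator γ) :
    (∃ F : Finset (subgroupH1 κ.kerSubgroup ↥((↥(W.geomPrimaryTorsion 2))[(2 : ℤ)])),
        (∀ c, c ∈ F ↔ (c ∈
          {c : subgroupH1 κ.kerSubgroup ↥((↥(W.geomPrimaryTorsion 2))[(2 : ℤ)]) |
            c ∈ unramifiedOutside κ.kerSubgroup ↥((↥(W.geomPrimaryTorsion 2))[(2 : ℤ)]) 2
                  (∅ : Set (HeightOneSpectrum (𝓞 ℚ))) ∧
              (∀ (w : InfinitePlace ℚ) (σ : Field.absoluteGaloisGroup ℚ),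
                Literature.NumberTheory.EllipticCurves.conjH1 κ.kerSubgroup ↥((↥(W.geomPrimaryTorsion 2))[(2 : ℤ)]) σ c ∈
                  GreenbergSelmer.infKer κ.kerSubgroup ↥((↥(W.geomPrimaryTorsion 2))[(2 : ℤ)]) w) ∧
              (∀ (v : HeightOneSpectrum (𝓞 ℚ)), ((2 : ℕ) : 𝓞 ℚ) ∈ v.asIdeal → ∀ σ : Field.absoluteGaloisGroup ℚ,
                W.conjH1 2 κ.kerSubgroup σ
                    (pushH1 κ.kerSubgroup ((↥(W.geomPrimaryTorsion 2))[(2 : ℤ)]).subtype (subtype_torsionBy_smul W 2) c) ∈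
                  localKummerOverOfEmb W 2 κ.kerSubgroup (closureEmb (K := ℚ) (v.adicCompletion ℚ))
                    (⨆ n : ℕ, signedLocalPoints κ (v.adicCompletion ℚ) W 1 n))} ∧
          ((@HSub.hSub (AddMonoid.End (subgroupH1 κ.kerSubgroup ↥((↥(W.geomPrimaryTorsion 2))[(2 : ℤ)])))
              (AddMonoid.End (subgroupH1 κ.kerSubgroup ↥((↥(W.geomPrimaryTorsion 2))[(2 : ℤ)])))
              (AddMonoid.End (subgroupH1 κ.kerSubgroup ↥((↥(W.geomPrimaryTorsion 2))[(2 : ℤ)]))) instHSub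
              (Literature.NumberTheory.EllipticCurves.conjH1 κ.kerSubgroup ↥((↥(W.geomPrimaryTorsion 2))[(2 : ℤ)]) γ) 1) ^
            1) c = 0)) ∧
        F.card < 2 ^ 1) ↔
    (∀ c₀ : subgroupH1 (κ.layerSubgroup 0) ↥((↥(W.geomPrimaryTorsion 2))[(2 : ℤ)]),
      (Literature.NumberTheory.EllipticCurves.resOfLe ↥((↥(W.geomPrimaryTorsion 2))[(2 : ℤ)]) (κ.kerSubgroup_le_layerSubgroup 0) c₀ ∈
          unramifiedOutside κ.kerSubgroup ↥((↥(W.geomPrimaryTorsion 2))[(2 : ℤ)]) 2 (∅ : Set (HeightOneSpectrum (𝓞 ℚ))) ∧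
        (∀ (w : InfinitePlace ℚ) (σ : Field.absoluteGaloisGroup ℚ),
          Literature.NumberTheory.EllipticCurves.conjH1 κ.kerSubgroup ↥((↥(W.geomPrimaryTorsion 2))[(2 : ℤ)]) σ
              (Literature.NumberTheory.EllipticCurves.resOfLe ↥((↥(W.geomPrimaryTorsion 2))[(2 : ℤ)])
                (κ.kerSubgroup_le_layerSubgroup 0) c₀) ∈
            GreenbergSelmer.infKer κ.kerSubgroup ↥((↥(W.geomPrimaryTorsion 2))[(2 : ℤ)]) w) ∧
        (∀ (v : HeightOneSpectrum (𝓞 ℚ)), ((2 : ℕ) : 𝓞 ℚ) ∈ v.asIdeal → ∀ σ : Field.absoluteGaloisGroup ℚ,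
          W.conjH1 2 κ.kerSubgroup σ
              (pushH1 κ.kerSubgroup ((↥(W.geomPrimaryTorsion 2))[(2 : ℤ)]).subtype (subtype_torsionBy_smul W 2)
                (Literature.NumberTheory.EllipticCurves.resOfLe ↥((↥(W.geomPrimaryTorsion 2))[(2 : ℤ)])
                  (κ.kerSubgroup_le_layerSubgroup 0) c₀)) ∈
            localKummerOverOfEmb W 2 κ.kerSubgroup (closureEmb (K := ℚ) (v.adicCompletion ℚ))
              (⨆ n : ℕ, signedLocalPoints κ (v.adicCompletion ℚ) W 1 n))) →
      c₀ = 0) := by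
  -- notation
  set M : Type := ↥((↥(W.geomPrimaryTorsion 2))[(2 : ℤ)]) with hM
  set res := Literature.NumberTheory.EllipticCurves.resOfLe M (κ.kerSubgroup_le_layerSubgroup 0) with hres
  set φ := Literature.NumberTheory.EllipticCurves.conjH1 κ.kerSubgroup M γ with hφ
  set kW := pushH1 κ.kerSubgroup ((↥(W.geomPrimaryTorsion 2))[(2 : ℤ)]).subtype (subtype_torsionBy_smul W 2) with hkW
  -- the operator `T = conj_γ − 1` applied once
  have hT : ∀ c : subgroupH1 κ.kerSubgroup M,
      ((@HSub.hSub (AddMonoid.End (subgroupH1 κ.kerSubgroup M)) (AddMonoid.End (subgroupH1 κ.kerSubgroup M))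
          (AddMonoid.End (subgroupH1 κ.kerSubgroup M)) instHSub φ 1) ^ 1) c = φ c - c := fun c ↦ by
    rw [pow_one, IwasawaDual.End_sub_apply, AddMonoid.End.coe_one, id]
    rfl
  -- `0 ∈ R`
  have h0R : (0 : subgroupH1 κ.kerSubgroup M) ∈ unramifiedOutside κ.kerSubgroup M 2 (∅ : Set (HeightOneSpectrum (𝓞 ℚ))) ∧
      (∀ (w : InfinitePlace ℚ) (σ : Field.absoluteGaloisGroup ℚ),
        Literature.NumberTheory.EllipticCurves.conjH1 κ.kerSubgroup M σ 0 ∈ GreenbergSelmer.infKer κ.kerSubgroup M w) ∧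
      (∀ (v : HeightOneSpectrum (𝓞 ℚ)), ((2 : ℕ) : 𝓞 ℚ) ∈ v.asIdeal → ∀ σ : Field.absoluteGaloisGroup ℚ,
        W.conjH1 2 κ.kerSubgroup σ (kW 0) ∈
          localKummerOverOfEmb W 2 κ.kerSubgroup (closureEmb (K := ℚ) (v.adicCompletion ℚ))
            (⨆ n : ℕ, signedLocalPoints κ (v.adicCompletion ℚ) W 1 n)) :=
    ⟨zero_mem _, fun w σ ↦ by rw [map_zero]; exact zero_mem _, fun v hv σ ↦ by rw [map_zero, map_zero]; exact zero_mem _⟩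
  constructor
  · -- ⇒: `F = {0}`; a restricted class in `R` is `conj_γ`-fixed, lies in `F`, is `0`; restriction is injective
    rintro ⟨F, hF, hcard⟩ c₀ hc₀
    have h0F : (0 : subgroupH1 κ.kerSubgroup M) ∈ F := (hF 0).mpr ⟨h0R, by rw [hT, map_zero, sub_self]⟩
    have hfix : φ (res c₀) = res c₀ := conjH1_resOfLe_layerZero W κ γ c₀
    have hcF : res c₀ ∈ F := (hF _).mpr ⟨hc₀, by rw [hT, hfix, sub_self]⟩
    have hF1 : F.card ≤ 1 := by rw [pow_one] at hcard; omega
    have heq : res c₀ = 0 := Finset.card_le_one.mp hF1 _ hcF _ h0F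
    exact resOfLe_layerZero_injective W hss κ (by rw [map_zero]; exact heq)
  · -- ⇐: `R[T] = {0}`
    intro h
    refine ⟨{0}, fun c ↦ ⟨fun hc ↦ ?_, fun hc ↦ ?_⟩, by rw [Finset.card_singleton, pow_one]; exact one_lt_two⟩
    · rw [Finset.mem_singleton] at hc
      subst hc
      exact ⟨h0R, by rw [hT, map_zero, sub_self]⟩
    · obtain ⟨hcR, hcT⟩ := hc
      rw [hT, sub_eq_zero] at hcT
      obtain ⟨c₀, rfl⟩ := exists_resOfLe_eq_of_conjH1_eq W κ hγ c hcT
      rw [Finset.mem_singleton, h c₀ hcR, map_zero]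

end Certificate

/-! ## §3. The per-curve door at layer `0` -/

/-- **Per-curve door, layer-`0` form.** For `W/ℚ` globally minimal, good supersingular at `2`, `Δ_W < 0`, a cyclotomic `κ` with
topological generator `γ`: if every class of `H¹(ℚ_0, W[2^∞][2])` whose restriction to `ℚ_∞` is primitive residual signed-plus
vanishes (`R₀ = 0`), then every finitely generated `+` signed Selmer dual of `W` at `(κ, γ)` is `Λ`-torsion with `μ = 0`
(`primCertificate_one_iff_layerZero` + `isTorsion_and_mu_eq_zero_of_primCertificate` at `q = 1`).
[cite: GreenbergLNM1716, §3 Lemma 3.2 (PDF p. 86)] [cite: Fukuda1994, Thm. 1] [cite: Kobayashi2003, Def. 1.1] -/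
theorem isTorsion_and_mu_eq_zero_of_layerZero (W : WeierstrassCurve ℚ) [W.IsElliptic] [W.IsGloballyMinimal]
    (hss : GoodSS W 2) (hΔ : W.Δ < 0) (κ : ZpExtension ℚ 2) (γ : Field.absoluteGaloisGroup ℚ)
    (hκ : κ.IsCyclotomic) (hγ : κ.IsTopGenerator γ)
    (h0 : ∀ c₀ : subgroupH1 (κ.layerSubgroup 0) ↥((↥(W.geomPrimaryTorsion 2))[(2 : ℤ)]),
      (Literature.NumberTheory.EllipticCurves.resOfLe ↥((↥(W.geomPrimaryTorsion 2))[(2 : ℤ)]) (κ.kerSubgroup_le_layerSubgroup 0) c₀ ∈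
          unramifiedOutside κ.kerSubgroup ↥((↥(W.geomPrimaryTorsion 2))[(2 : ℤ)]) 2 (∅ : Set (HeightOneSpectrum (𝓞 ℚ))) ∧
        (∀ (w : InfinitePlace ℚ) (σ : Field.absoluteGaloisGroup ℚ),
          Literature.NumberTheory.EllipticCurves.conjH1 κ.kerSubgroup ↥((↥(W.geomPrimaryTorsion 2))[(2 : ℤ)]) σ
              (Literature.NumberTheory.EllipticCurves.resOfLe ↥((↥(W.geomPrimaryTorsion 2))[(2 : ℤ)])
                (κ.kerSubgroup_le_layerSubgroup 0) c₀) ∈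
            GreenbergSelmer.infKer κ.kerSubgroup ↥((↥(W.geomPrimaryTorsion 2))[(2 : ℤ)]) w) ∧
        (∀ (v : HeightOneSpectrum (𝓞 ℚ)), ((2 : ℕ) : 𝓞 ℚ) ∈ v.asIdeal → ∀ σ : Field.absoluteGaloisGroup ℚ,
          W.conjH1 2 κ.kerSubgroup σ
              (pushH1 κ.kerSubgroup ((↥(W.geomPrimaryTorsion 2))[(2 : ℤ)]).subtype (subtype_torsionBy_smul W 2)
                (Literature.NumberTheory.EllipticCurves.resOfLe ↥((↥(W.geomPrimaryTorsion 2))[(2 : ℤ)])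
                  (κ.kerSubgroup_le_layerSubgroup 0) c₀)) ∈
            localKummerOverOfEmb W 2 κ.kerSubgroup (closureEmb (K := ℚ) (v.adicCompletion ℚ))
              (⨆ n : ℕ, signedLocalPoints κ (v.adicCompletion ℚ) W 1 n))) →
      c₀ = 0)
    (D : SignedSelmerDualData W κ γ 1) [Module.Finite (IwasawaAlgebra 2) D.X] :
    Module.IsTorsion (IwasawaAlgebra 2) D.X ∧ D.mu = 0 :=
  isTorsion_and_mu_eq_zero_of_primCertificate W hss hΔ κ γ hκ hγ 1 le_rfl
    ((primCertificate_one_iff_layerZero W hss κ γ hγ).mpr h0) D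

end Summit.BirchSwinnertonDyer.BirchSwinnertonDyer.Theorems.SignedMuAtTwo.NormOneTorus

end
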